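import Mathlib
import HarnessLib
import Literature.Computability.AlgebraicComplexity.KabanetsImpagliazzoGenerator
import Literature.Computability.AlgebraicComplexity.KRSTDesign
import Literature.Computability.AlgebraicComplexity.ArithCircuitVars
import Literature.Computability.AlgebraicComplexity.BLMW11FormulasWeaklySkew
import Summits.ValiantsHypothesis.ValiantsHypothesis.Theorems.DefinabilityGapAffineRung

/-!
# DefinabilityGap — the SUPPORT / SIZE rung of K1 and K1ws (kernel, unconditional)
# (support for `KIPlantedHitting`, item `stmt-ValiantsHypothesis-23547`)

Support for route `route-ValiantsHypothesis-DefinabilityGap` (decomp-valiant lens 5; BC5 witness for the residual crux K1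
`KIPlantedHitting` and its split child K1ws `KIPlantedHittingWs`, in their OWN currencies — circuit size resp. weakly-skew
size, degree-free). For every `m`, the KI-planted permanent map `G_m = kiPer m` hits every nonzero `D` with
`2(|vars D| − 1) < m²` (`kiPer_hits_support`), hence every nonzero `D` with `4·L(D) < m²` (`kiPer_hits_size`) and every
nonzero `D` with `4·L_ws(D) < m²` (`kiPer_hits_wsSize`). Compare the first integer rung `b = 1` of K1 / K1ws: size
`≤ q(m) ≈ m²` — the kernel rung sits a constant factor `4` below it. Mechanism = the route's lever (the NW-design
intersection property driving KI's hybrid argument): few block permanents of an NW design with parameter 2 are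
ALGEBRAICALLY INDEPENDENT, because each of `≤ (m²+1)/2` blocks keeps a private cell, and the substitution
"private cell ↦ X_c, every other cell ↦ 1" maps `per_m(y|S_c) ↦ N₁·X_c + N₂` with `N₁ ≥ 1`.
-/

noncomputable section

open MvPolynomial
open Literature.Computability.AlgebraicComplexity Literature.Computability.MetaComplexity
open Summit.ValiantsHypothesis.ValiantsHypothesis.Theorems.DefinabilityGapAffineRung
  (qOf qOf_spec sq_le_qOf quadDesign kiPer quadDesign_isNWDesign)

namespace Summit.ValiantsHypothesis.ValiantsHypothesis.Theorems.DefinabilityGapSupportRung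

namespace KIPrivate

open Finset Function

variable {F : Type*} [Field F]

/-- Affine images `a_c X_c + b_c` (`a_c ≠ 0`) of distinct variables are algebraically independent. [folklore] -/
theorem algebraicIndependent_affine {T : Type*} (a b : T → F) (ha : ∀ c, a c ≠ 0) :
    AlgebraicIndependent F (fun c : T => (C (a c) * X c + C (b c) : MvPolynomial T F)) := by
  rw [algebraicIndependent_iff_injective_aeval]
  set ψ : MvPolynomial T F →ₐ[F] MvPolynomial T F :=
    aeval (fun c : T => (C (a c) * X c + C (b c) : MvPolynomial T F)) with hψ
  let ψ' : MvPolynomial T F →ₐ[F] MvPolynomial T F :=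
    aeval (fun c : T => (C (a c)⁻¹ * (X c - C (b c)) : MvPolynomial T F))
  have h : ψ'.comp ψ = AlgHom.id F _ := by
    refine MvPolynomial.algHom_ext fun c => ?_
    simp only [ψ', hψ, AlgHom.comp_apply, aeval_X, map_add, map_mul, aeval_C, algebraMap_eq,
      AlgHom.id_apply]
    rw [← mul_assoc, ← C_mul, mul_inv_cancel₀ (ha c), C_1, one_mul, sub_add_cancel]
  intro p q hpq
  have := congrArg ψ' hpq
  rwa [← AlgHom.comp_apply, ← AlgHom.comp_apply, h] at this

/-- The number of permutations of `Fin m` sending `p.2 ↦ p.1`. [folklore] -/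
def N₁ {m : ℕ} (p : Fin m × Fin m) : ℕ := (univ.filter fun σ : Equiv.Perm (Fin m) => σ p.2 = p.1).card

/-- The number of permutations of `Fin m` NOT sending `p.2 ↦ p.1`. [folklore] -/
def N₂ {m : ℕ} (p : Fin m × Fin m) : ℕ := (univ.filter fun σ : Equiv.Perm (Fin m) => ¬ σ p.2 = p.1).card

/-- `N₁ p ≥ 1`: the transposition `swap p.1 p.2` sends `p.2 ↦ p.1`. [folklore] -/
theorem N₁_pos {m : ℕ} (p : Fin m × Fin m) : 0 < N₁ p := by
  classical
  unfold N₁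
  rw [Finset.card_pos]
  exact ⟨Equiv.swap p.2 p.1, by simp [Equiv.swap_apply_left]⟩

/-- The permanent under "one variable ↦ x, all others ↦ 1": `N₁ · x + N₂`. [folklore] -/
theorem aeval_perPoly_indicator {m : ℕ} (p : Fin m × Fin m) {A : Type*} [CommRing A] [Algebra F A]
    (x : A) :
    aeval (fun ij : Fin m × Fin m => if ij = p then x else 1) (perPoly (Fin m) F) =
      (N₁ p : A) * x + (N₂ p : A) := by
  classical
  have hper : perPoly (Fin m) F = ∑ σ : Equiv.Perm (Fin m), ∏ i, (X (σ i, i) : MvPolynomial _ F) := by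
    rw [perPoly, Matrix.permanent]; rfl
  rw [hper, map_sum]
  have hterm : ∀ σ : Equiv.Perm (Fin m),
      aeval (fun ij : Fin m × Fin m => if ij = p then x else 1) (∏ i, (X (σ i, i) : MvPolynomial _ F)) =
        if σ p.2 = p.1 then x else 1 := by
    intro σ
    rw [map_prod]
    simp only [aeval_X]
    rw [Finset.prod_eq_single p.2]
    · by_cases h : σ p.2 = p.1
      · have hp : (σ p.2, p.2) = p := Prod.ext h rfl
        rw [if_pos h, if_pos hp]
      · have hp : (σ p.2, p.2) ≠ p := fun h' => h (Prod.ext_iff.1 h').1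
        rw [if_neg h, if_neg hp]
    · intro i _ hi
      rw [if_neg (fun h' => hi (Prod.ext_iff.1 h').2)]
    · intro h; exact absurd (mem_univ _) h
  simp_rw [hterm]
  rw [Finset.sum_ite, sum_const, sum_const, N₁, N₂]
  simp [nsmul_eq_mul]

variable {ι α : Type*} [DecidableEq α]

/-- Restricting the block positions along an embedding keeps the design property. [cite: KabanetsImpagliazzo2003, Lemma 30 (design argument)] -/
theorem isNWDesign_trans_left {β β' : Type*} [Fintype β] [Fintype β'] {a : ℕ} {e : ι → (β ↪ α)}
    (h : IsNWDesign a e) (v : β' ↪ β) : IsNWDesign a (fun i => v.trans (e i)) := by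
  intro i j hij
  refine (card_le_card (inter_subset_inter ?_ ?_)).trans (h hij) <;>
  · intro x hx
    obtain ⟨y, -, rfl⟩ := mem_map.1 hx
    exact mem_map.2 ⟨v y, mem_univ _, rfl⟩

/-- **Private points.** In a design with parameter `r`, every block of a set `T` of blocks with
`r · (|T| − 1) < m²` has a point outside all other blocks of `T`. [cite: KabanetsImpagliazzo2003, Lemma 30 (design argument)] -/
theorem exists_private {m r : ℕ} {E : ι → (Fin m × Fin m ↪ α)} (hE : IsNWDesign r E)
    (T : Finset ι) (hT : r * (T.card - 1) < m * m) {c : ι} (hc : c ∈ T) :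
    ∃ p : Fin m × Fin m, ∀ c' ∈ T, c' ≠ c → E c p ∉ univ.map (E c') := by
  classical
  by_contra h
  push Not at h
  set Bad := (T.erase c).biUnion fun c' => univ.map (E c) ∩ univ.map (E c') with hBad
  have hsub : univ.map (E c) ⊆ Bad := by
    intro x hx
    obtain ⟨p, -, rfl⟩ := mem_map.1 hx
    obtain ⟨c', hc'T, hne, hmem⟩ := h p
    exact mem_biUnion.2 ⟨c', mem_erase.2 ⟨hne, hc'T⟩, mem_inter.2 ⟨hx, hmem⟩⟩
  have hcard : (univ.map (E c)).card ≤ r * (T.card - 1) := by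
    refine (card_le_card hsub).trans (card_biUnion_le.trans ?_)
    calc ∑ c' ∈ T.erase c, (univ.map (E c) ∩ univ.map (E c')).card ≤ ∑ c' ∈ T.erase c, r :=
          sum_le_sum fun c' hc' => hE (mem_erase.1 hc').1.symm
      _ = r * (T.card - 1) := by rw [sum_const, smul_eq_mul, card_erase_of_mem hc, mul_comm]
  rw [card_map, card_univ, Fintype.card_prod, Fintype.card_fin] at hcard
  omega

/-- **Algebraic independence of few block permanents** (unconditional): for an NW design with parameter
`r` and blocks `T` with `r · (|T| − 1) < m²`, the polynomials `per_m(y|E_c)`, `c ∈ T`, are algebraically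
independent over `F` (`char F = 0`). [cite: KabanetsImpagliazzo2003, Lemma 30 (design argument)] -/
theorem algebraicIndependent_kiGenerator_perPoly [CharZero F] {m r : ℕ} {E : ι → (Fin m × Fin m ↪ α)}
    (hE : IsNWDesign r E) (T : Finset ι) (hT : r * (T.card - 1) < m * m) :
    AlgebraicIndependent F (fun c : T => kiGenerator (perPoly (Fin m) F) E c) := by
  classical
  have hm : 0 < m := Nat.pos_of_ne_zero (by rintro rfl; simp at hT)
  haveI : Nonempty (Fin m × Fin m) := ⟨(⟨0, hm⟩, ⟨0, hm⟩)⟩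
  have hpriv := fun c (hc : c ∈ T) => exists_private hE T hT hc
  choose! pt hpt using hpriv
  -- the private points are pairwise distinct across blocks
  have hv : ∀ c ∈ T, ∀ c' ∈ T, E c (pt c) = E c' (pt c') → c = c' := by
    intro c hc c' hc' h
    by_contra hne
    exact hpt c' hc' c hc hne (mem_map.2 ⟨pt c, mem_univ _, h⟩)
  -- the substitution: private point of `c` ↦ `X c`, everything else ↦ `1`
  let s : α → MvPolynomial T F := fun x =>
    if h : ∃ c : T, E c (pt c) = x then X h.choose else 1
  refine AlgebraicIndependent.of_comp (aeval s) ?_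
  have hs : ∀ c : T, ∀ ij : Fin m × Fin m,
      s (E c ij) = if ij = pt c then (X c : MvPolynomial T F) else 1 := by
    intro c ij
    by_cases hij : ij = pt c
    · have hex : ∃ c₀ : T, E c₀ (pt c₀) = E c ij := ⟨c, by rw [hij]⟩
      have h1 : s (E c ij) = X hex.choose := dif_pos hex
      have h2 : (hex.choose : ι) = c :=
        hv _ hex.choose.2 _ c.2 (by rw [hex.choose_spec, hij])
      rw [h1, if_pos hij, Subtype.ext h2]
    · rw [if_neg hij]
      have hnex : ¬ ∃ c₀ : T, E c₀ (pt c₀) = E c ij := by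
        rintro ⟨c₀, hc₀⟩
        by_cases h0 : (c₀ : ι) = c
        · apply hij
          have h1 := hc₀
          rw [h0] at h1
          exact ((E c).injective h1).symm
        · exact hpt c₀ c₀.2 c c.2 (Ne.symm h0) (mem_map.2 ⟨ij, mem_univ _, hc₀.symm⟩)
      exact dif_neg hnex
  have key : (aeval s : MvPolynomial α F →ₐ[F] MvPolynomial T F) ∘
      (fun c : T => kiGenerator (perPoly (Fin m) F) E c) =
      fun c : T => C ((N₁ (pt c) : F)) * X c + C ((N₂ (pt c) : F)) := by
    funext c
    simp only [Function.comp_apply, kiGenerator_apply, aeval_rename]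
    have : (s ∘ E c) = fun ij => if ij = pt c then (X c : MvPolynomial T F) else 1 := funext (hs c)
    rw [this, aeval_perPoly_indicator]
    simp [map_natCast]
  rw [key]
  exact algebraicIndependent_affine _ _ fun c => by
    have := N₁_pos (pt (c : ι)); exact_mod_cast this.ne'

/-- **Hitting few-variable polynomials** (unconditional): a nonzero `D` whose variables form a set `T` with
`r · (|T| − 1) < m²` is not annihilated: `D ∘ KI-gen_{per_m, E} ≠ 0`. [folklore] -/
theorem bind₁_kiGenerator_perPoly_ne_zero [CharZero F] {m r : ℕ} {E : ι → (Fin m × Fin m ↪ α)}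
    (hE : IsNWDesign r E) {D : MvPolynomial ι F} (hD : D ≠ 0)
    (hvars : r * (D.vars.card - 1) < m * m) :
    bind₁ (kiGenerator (perPoly (Fin m) F) E) D ≠ 0 := by
  classical
  set T := D.vars with hT
  obtain ⟨D', hD'⟩ := exists_rename_eq_of_vars_subset_range D ((↑) : T → ι) Subtype.val_injective
    (by simp [hT])
  have hind := algebraicIndependent_kiGenerator_perPoly (F := F) hE T hvars
  have hD'0 : D' ≠ 0 := by
    rintro rfl
    exact hD (by rw [← hD', map_zero])
  rw [← hD', bind₁_rename]
  exact fun h => hD'0 (hind.eq_zero_of_aeval_eq_zero D' h)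

end KIPrivate

/-- The planted generator is the KI generator of `per_m` itself on the sub-blocks `permPad ≫ quadDesign`. [cite: KabanetsImpagliazzo2003, Lemma 30 (design argument)] -/
theorem kiPer_eq_kiGenerator_perPoly (m : ℕ) :
    kiPer m = kiGenerator (perPoly (Fin m) ℂ) (fun c => (permPad (sq_le_qOf m)).trans (quadDesign m c)) := by
  funext c
  rw [kiPer, kiGenerator_apply, kiGenerator_apply, perPad, rename_rename]
  rfl

/-- The sub-blocks still form an NW design with parameter `2`. [cite: KabanetsImpagliazzo2003, Lemma 30 (design argument)] -/
theorem subDesign_isNWDesign (m : ℕ) :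
    IsNWDesign 2 (fun c => (permPad (sq_le_qOf m)).trans (quadDesign m c)) :=
  KIPrivate.isNWDesign_trans_left (quadDesign_isNWDesign m) _

/-- **Few block permanents of `G_m` are algebraically independent** (KERNEL, unconditional). [cite: KabanetsImpagliazzo2003, Lemma 30 (design argument)] -/
theorem kiPer_algebraicIndependent (m : ℕ) (T : Finset (Fin 3 → Fin (qOf m))) (hT : 2 * (T.card - 1) < m * m) :
    AlgebraicIndependent ℂ (fun c : T => kiPer m c) := by
  rw [kiPer_eq_kiGenerator_perPoly]
  exact KIPrivate.algebraicIndependent_kiGenerator_perPoly (subDesign_isNWDesign m) T hT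

/-- **K1 rung, support form** (KERNEL, unconditional): a nonzero `D` with `2(|vars D| − 1) < m²` is hit by `G_m`. [cite: KabanetsImpagliazzo2003, Lemma 30 (design argument)] -/
theorem kiPer_hits_support (m : ℕ) {D : MvPolynomial (Fin 3 → Fin (qOf m)) ℂ} (hD : D ≠ 0)
    (hsmall : 2 * (D.vars.card - 1) < m * m) : bind₁ (kiPer m) D ≠ 0 := by
  rw [kiPer_eq_kiGenerator_perPoly]
  exact KIPrivate.bind₁_kiGenerator_perPoly_ne_zero (subDesign_isNWDesign m) hD hsmall

/-- **K1 rung in K1's own quantifier shape** (KERNEL, unconditional): for every support bound `t` the planted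
generator hits, for all large `m` (here: some `m ≥ m₀`, indeed every `m > 2t`), every nonzero polynomial in at most
`t` of its variables — compare `KIPlantedHitting`, which asks this for all `D` of size and degree `≤ q(m)^b`. [cite: KabanetsImpagliazzo2003, Lemma 30 (design argument)] -/
theorem kiPer_hits_support_eventually (t m₀ : ℕ) : ∃ m, m₀ ≤ m ∧
    ∀ D : MvPolynomial (Fin 3 → Fin (qOf m)) ℂ, D ≠ 0 → D.vars.card ≤ t → bind₁ (kiPer m) D ≠ 0 := by
  refine ⟨m₀ + 2 * t + 1, by omega, fun D hD ht => kiPer_hits_support _ hD ?_⟩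
  have h1 : 2 * (D.vars.card - 1) < 2 * t + 1 := by omega
  have h2 : 2 * t + 1 ≤ (m₀ + 2 * t + 1) * (m₀ + 2 * t + 1) :=
    le_trans (by omega) (Nat.le_mul_self _)
  exact lt_of_lt_of_le h1 h2


/-- **K1 rung in K1's own currency — circuit SIZE, degree-free** (KERNEL, unconditional): every nonzero `D` of
circuit complexity `< m²/4` is hit by `G_m`, for EVERY `m` (via `|vars D| ≤ 2·L(D) + 1`, tree
`ArithCircuit.card_vars_le_two_mul_complexity_add_one`). Compare K1's first integer rung `b = 1`: complexity `≤ q(m) ≈ m²`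
(and degree `≤ q`); the kernel rung sits a constant factor `4` below it in size and needs no degree bound. [cite: KabanetsImpagliazzo2003, Lemma 30 (design argument)] -/
theorem kiPer_hits_size (m : ℕ) {D : MvPolynomial (Fin 3 → Fin (qOf m)) ℂ} (hD : D ≠ 0)
    (hsize : 4 * complexity D < m * m) : bind₁ (kiPer m) D ≠ 0 := by
  refine kiPer_hits_support m hD (lt_of_le_of_lt ?_ hsize)
  have h := ArithCircuit.card_vars_le_two_mul_complexity_add_one D
  omega

/-- The size rung in the literal quantifier shape of `KIPlantedHitting` with the scale `q^b` replaced by `m²/4`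
(all `m ≥ m₀` work; no degree hypothesis is needed). [folklore] -/
theorem kiPer_hits_size' (m₀ : ℕ) : ∃ m, m₀ ≤ m ∧
    ∀ D : MvPolynomial (Fin 3 → Fin (qOf m)) ℂ, D ≠ 0 → 4 * complexity D < m * m → bind₁ (kiPer m) D ≠ 0 :=
  ⟨m₀, le_rfl, fun _ hD hs => kiPer_hits_size m₀ hD hs⟩

/-- **K1ws rung — weakly-skew SIZE** (KERNEL, unconditional): every nonzero `D` with `4·L_ws(D) < m²` is hit by `G_m`,
for EVERY `m` (`L ≤ L_ws`). The split child K1ws asks this with `q(m)^b` in place of `m²/4`, for every `b`, i.o. in `m`.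
[cite: KabanetsImpagliazzo2003, Lemma 30; BurgisserEtAl2011, §9.1] -/
theorem kiPer_hits_wsSize (m : ℕ) {D : MvPolynomial (Fin 3 → Fin (qOf m)) ℂ} (hD : D ≠ 0)
    (hsize : 4 * wsComplexity D < m * m) : bind₁ (kiPer m) D ≠ 0 :=
  kiPer_hits_size m hD (lt_of_le_of_lt (Nat.mul_le_mul_left 4 (complexity_le_wsComplexity D)) hsize)

/-- The ws-size rung in the literal quantifier shape of `KIPlantedHittingWs` with the scale `q^b` replaced by `m²/4`.
[cite: KabanetsImpagliazzo2003, Lemma 30] -/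
theorem kiPer_hits_wsSize' (m₀ : ℕ) : ∃ m, m₀ ≤ m ∧
    ∀ D : MvPolynomial (Fin 3 → Fin (qOf m)) ℂ, D ≠ 0 → 4 * wsComplexity D < m * m → bind₁ (kiPer m) D ≠ 0 :=
  ⟨m₀, le_rfl, fun _ hD hs => kiPer_hits_wsSize m₀ hD hs⟩

end Summit.ValiantsHypothesis.ValiantsHypothesis.Theorems.DefinabilityGapSupportRung

end
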